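import Literature.Analysis.FluidPDE.BiotSavartCurlPair
import Literature.Analysis.FluidPDE.AncientSimilarityVorticity
import Literature.Analysis.FluidPDE.SverakLandauConformalCalc
import Summits.NavierStokesRegularity.NavierStokesRegularity.Theorems.UnthreadedDoorCapSymZonalToroidalInductionAlgebra
import HarnessLib

/-!
# Poloidal / toroidal field calculus about a centre: `curl(φ y) = ∇φ × y`, `curl curl(φ y)`, Euler's identity

Support file for crux `PoloidalLiouville` (stmt-NavierStokesRegularity-1222, W1; Theorems-side tooling, `--as helper`).  Pointwise vector-calculus identities on `ℝ³` for the fields the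
W1/W2 lines of crux `PoloidalLiouville` / `UnthreadedRigidity` are built from (toroidal `curl(φ y) = ∇φ × y`, poloidal
`curl curl(φ y)`; `pub/ns-exp-scalarLiouville`, ARM A g3, tooling for ns-idea-15's «horizon-threading-tower» first lemma
`HorizonProfileStructure` and the B-ht1 slice lemma; nothing here is specific to Navier–Stokes):

* `PoloidalField.curl_smul_self` — `curl (y ↦ φ(y) y)(x) = ∇φ(x) × x` (`φ` differentiable at `x`); hence toroidal fields
  are tangent to the spheres about the centre (`inner_curl_smul_self`).
* `PoloidalField.curl_cross_self` — `curl (y ↦ W(y) × y)(x) = DW(x)[x] + 2W(x) − (div W)(x) x`.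
* `PoloidalField.curl_curl_smul_self` — `curl curl (φ y)(x) = D(∇φ)(x)[x] + 2∇φ(x) − (div ∇φ)(x) x`.
* `PoloidalField.fderiv_apply_self_of_homogeneous` — EULER: if `f(c x) = a(c) • f(x)` for `c` near `1` and `f` is
  differentiable at `x`, then `Df(x)[x] = a′(1) • f(x)`; `gradient_smul_of_oneHomogeneous` — the gradient of a
  degree-one homogeneous function is degree-zero homogeneous.
* `PoloidalField.curl_curl_smul_self_of_oneHomogeneous` — for `φ` homogeneous of degree one (`φ(cy) = cφ(y)`, `c > 0`),
  `C¹` near `x` with `∇φ` differentiable at `x`: `curl curl(φ y)(x) = 2∇φ(x) − (div ∇φ)(x) x` — the horizon-profile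
  normal form (`U = f ξ + r∇Φ` of the sketch after the substitution `φ = r^{1−l}H`).
* `PoloidalField.curl_gradient_eq_zero_of_contDiffAt` — `curl ∇θ (x) = 0` for `θ` of class `C²` AT `x` (local form of
  the tree's `curl_gradient_eq_zero_holds`), and `inner_curl_sub_smul_self` — `⟪curl(2∇φ − ψ y)(x), x⟫ = 0`:
  poloidal fields of the normal form have tangential curl.

[cite: MajdaBertozziCUP2002, §1.1 (vector identities), §2.4.1]  Pure calculus; no statement about any PDE.
-/

-- the summit and its single problem share the name (D-0017 nested layout)
set_option linter.dupNamespace false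

noncomputable section

open Set Function Filter Topology
open scoped Topology RealInnerProductSpace
open Literature.Analysis.FluidPDE

namespace Summit.NavierStokesRegularity.NavierStokesRegularity.Theorems.PoloidalLiouville

namespace PoloidalField

/-! ### Toroidal fields `φ y` -/

/-- `⟪a × x, x⟫ = 0` (scalar triple product with a repeated vector). [folklore] -/
private theorem inner_cross_self_right' (a x : EuclideanSpace ℝ (Fin 3)) : ⟪cross a x, x⟫ = 0 := by
  simp only [cross, PiLp.inner_apply, RCLike.inner_apply, conj_trivial, Fin.sum_univ_three, cross_apply,
    Matrix.cons_val_zero, Matrix.cons_val_one, Matrix.cons_val_two, Matrix.head_cons, Matrix.tail_cons]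
  ring


/-- **`curl (φ y) = ∇φ × y`**: `curl (y ↦ φ(y) • y)(x) = ∇φ(x) × x` for `φ` differentiable at `x`
(`curl (φ f) = φ curl f + ∇φ × f` with `curl y = 0`). [cite: MajdaBertozziCUP2002, §1.1 (vector identities)] -/
theorem curl_smul_self {φ : EuclideanSpace ℝ (Fin 3) → ℝ} {x : EuclideanSpace ℝ (Fin 3)}
    (hφ : DifferentiableAt ℝ φ x) :
    curl (fun y => φ y • y) x = cross (gradient φ x) x := by
  have h := curl_smul (f := fun y => y) hφ differentiableAt_id
  rw [h, CapSym.curl_self_eq_zero, smul_zero, zero_add, fderiv_eq_innerSL_gradient, curlCLM_smulRight_innerSL]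

/-- **Toroidal fields are tangent to the spheres**: `⟪curl (φ y)(x), x⟫ = 0` (`φ` differentiable at `x`). [folklore] -/
theorem inner_curl_smul_self {φ : EuclideanSpace ℝ (Fin 3) → ℝ} {x : EuclideanSpace ℝ (Fin 3)}
    (hφ : DifferentiableAt ℝ φ x) : ⟪curl (fun y => φ y • y) x, x⟫ = 0 := by
  rw [curl_smul_self hφ]
  exact inner_cross_self_right' _ _

/-! ### `curl (W × y)` and the poloidal field `curl curl (φ y)` -/

/-- **`curl (W × y) = DW[y] + 2W − (div W) y`** at a point where `W` is differentiable
(`curl (W × Ω) = DW[Ω] − (div W)Ω + (div Ω)W − DΩ[W]` with `Ω = y`, `div y = 3`, `Dy = id`).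
[cite: MajdaBertozziCUP2002, §1.1 (vector identities)] -/
theorem curl_cross_self {W : EuclideanSpace ℝ (Fin 3) → EuclideanSpace ℝ (Fin 3)} {x : EuclideanSpace ℝ (Fin 3)}
    (hW : DifferentiableAt ℝ W x) :
    curl (fun y => cross (W y) y) x
      = fderiv ℝ W x x + (2 : ℝ) • W x - (VectorCalculus.divergence W x) • x := by
  have h := curl_cross_apply (Ω := fun y => y) hW differentiableAt_id
  rw [h, Sverak2011.divergence_id_three, fderiv_fun_id]
  simp only [ContinuousLinearMap.id_apply]
  module

/-- **`curl curl (φ y) = D(∇φ)[y] + 2∇φ − (div ∇φ) y`** at `x`, for `φ` differentiable near `x` with `∇φ`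
differentiable at `x`. [cite: MajdaBertozziCUP2002, §1.1 (vector identities)] -/
theorem curl_curl_smul_self {φ : EuclideanSpace ℝ (Fin 3) → ℝ} {x : EuclideanSpace ℝ (Fin 3)}
    (hφ : ∀ᶠ y in 𝓝 x, DifferentiableAt ℝ φ y) (hg : DifferentiableAt ℝ (gradient φ) x) :
    curl (curl (fun y => φ y • y)) x
      = fderiv ℝ (gradient φ) x x + (2 : ℝ) • gradient φ x - (VectorCalculus.divergence (gradient φ) x) • x := by
  have hev : curl (fun y => φ y • y) =ᶠ[𝓝 x] fun y => cross (gradient φ y) y := by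
    filter_upwards [hφ] with y hy
    exact curl_smul_self hy
  rw [curl_eq_curlCLM, hev.fderiv_eq, ← curl_eq_curlCLM, curl_cross_self hg]

/-! ### Euler's identity for homogeneous functions -/

/-- **EULER'S IDENTITY.**  If `f(c • x) = a(c) • f(x)` for `c` in a neighbourhood of `1`, `a` has derivative `a′`
at `1` with `a(1) = 1`, and `f` is differentiable at `x`, then `Df(x)[x] = a′ • f(x)` (differentiate
`c ↦ f(c x)` at `c = 1` in two ways). [folklore] -/
theorem fderiv_apply_self_of_homogeneous {F : Type*} [NormedAddCommGroup F] [NormedSpace ℝ F]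
    {f : EuclideanSpace ℝ (Fin 3) → F} {x : EuclideanSpace ℝ (Fin 3)} {a : ℝ → ℝ} {a' : ℝ}
    (hf : DifferentiableAt ℝ f x) (ha : HasDerivAt a a' 1)
    (hhom : ∀ᶠ c in 𝓝 (1 : ℝ), f (c • x) = a c • f x) :
    fderiv ℝ f x x = a' • f x := by
  -- `c ↦ f (c • x)` has derivative `Df(x)[x]` at `1`
  have h1 : HasDerivAt (fun c : ℝ => f (c • x)) (fderiv ℝ f x x) 1 := by
    have hl : HasDerivAt (fun c : ℝ => c • x) x 1 := by
      simpa using (hasDerivAt_id (1 : ℝ)).smul_const x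
    have hf1 : HasFDerivAt f (fderiv ℝ f x) ((1 : ℝ) • x) := by rw [one_smul]; exact hf.hasFDerivAt
    exact hf1.comp_hasDerivAt 1 hl
  -- and derivative `a′ • f x` by homogeneity
  have h2 : HasDerivAt (fun c : ℝ => f (c • x)) (a' • f x) 1 :=
    (ha.smul_const (f x)).congr_of_eventuallyEq hhom
  exact h1.unique h2

/-- **Degree one**: `φ(cy) = cφ(y)` for `c > 0` and `φ` differentiable at `x` give `⟪∇φ(x), x⟫ = φ(x)`. [folklore] -/
theorem inner_gradient_self_of_oneHomogeneous {φ : EuclideanSpace ℝ (Fin 3) → ℝ} {x : EuclideanSpace ℝ (Fin 3)}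
    (hφ : DifferentiableAt ℝ φ x) (hhom : ∀ c : ℝ, 0 < c → ∀ y, φ (c • y) = c * φ y) :
    ⟪gradient φ x, x⟫ = φ x := by
  have hev : ∀ᶠ c in 𝓝 (1 : ℝ), φ (c • x) = (fun c => c) c • φ x := by
    filter_upwards [Ioi_mem_nhds (zero_lt_one' ℝ)] with c hc
    rw [hhom c hc x, smul_eq_mul]
  have h := fderiv_apply_self_of_homogeneous (a := fun c => c) hφ (hasDerivAt_id 1) hev
  rw [one_smul] at h
  rw [inner_gradient_left, h]

/-- **The gradient of a degree-one homogeneous function is degree-zero homogeneous**: `∇φ(c x) = ∇φ(x)` for `c > 0`,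
when `φ` is differentiable at `x` and at `c x`. [folklore] -/
theorem gradient_smul_of_oneHomogeneous {φ : EuclideanSpace ℝ (Fin 3) → ℝ} {x : EuclideanSpace ℝ (Fin 3)} {c : ℝ}
    (hc : 0 < c) (hφx : DifferentiableAt ℝ φ x) (hφc : DifferentiableAt ℝ φ (c • x))
    (hhom : ∀ c : ℝ, 0 < c → ∀ y, φ (c • y) = c * φ y) :
    gradient φ (c • x) = gradient φ x := by
  -- differentiate `φ (c • y) = c φ(y)` in `y` at `x`
  have hL : HasFDerivAt (fun y : EuclideanSpace ℝ (Fin 3) => c • y) (c • ContinuousLinearMap.id ℝ _) x :=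
    (hasFDerivAt_id x).const_smul c
  have h1 : HasFDerivAt (fun y => φ (c • y)) ((fderiv ℝ φ (c • x)).comp (c • ContinuousLinearMap.id ℝ _)) x :=
    hφc.hasFDerivAt.comp x hL
  have h2 : HasFDerivAt (fun y => φ (c • y)) (c • fderiv ℝ φ x) x := by
    have : (fun y => φ (c • y)) = fun y => c * φ y := funext fun y => hhom c hc y
    rw [this]
    exact hφx.hasFDerivAt.const_mul c
  have h3 : (fderiv ℝ φ (c • x)).comp (c • ContinuousLinearMap.id ℝ _) = c • fderiv ℝ φ x := h1.unique h2
  have h4 : fderiv ℝ φ (c • x) = fderiv ℝ φ x := by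
    have h5 : c • fderiv ℝ φ (c • x) = c • fderiv ℝ φ x := by
      rw [← h3]; ext v; simp
    exact smul_right_injective _ hc.ne' h5
  rw [gradient, gradient, h4]

/-- **Horizon-profile normal form**: for `φ` homogeneous of degree one (`φ(cy) = cφ(y)`, `c > 0`), differentiable
near `x ≠ 0`-or-not, with `∇φ` differentiable at `x`:  `curl curl (φ y)(x) = 2∇φ(x) − (div ∇φ)(x) • x`
(Euler for the degree-zero homogeneous `∇φ`: `D(∇φ)(x)[x] = 0`). [cite: MajdaBertozziCUP2002, §1.1 (vector identities)] -/
theorem curl_curl_smul_self_of_oneHomogeneous {φ : EuclideanSpace ℝ (Fin 3) → ℝ} {x : EuclideanSpace ℝ (Fin 3)}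
    (hφ : ∀ᶠ y in 𝓝 x, DifferentiableAt ℝ φ y) (hg : DifferentiableAt ℝ (gradient φ) x)
    (hhom : ∀ c : ℝ, 0 < c → ∀ y, φ (c • y) = c * φ y) :
    curl (curl (fun y => φ y • y)) x = (2 : ℝ) • gradient φ x - (VectorCalculus.divergence (gradient φ) x) • x := by
  rw [curl_curl_smul_self hφ hg]
  -- `D(∇φ)(x)[x] = 0` by Euler for the degree-zero homogeneous `∇φ`
  have hφx : DifferentiableAt ℝ φ x := hφ.self_of_nhds
  have hev : ∀ᶠ c in 𝓝 (1 : ℝ), gradient φ (c • x) = (fun _ => (1 : ℝ)) c • gradient φ x := by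
    -- differentiability of `φ` at `c • x` for `c` near `1`: continuity of `c ↦ c • x`
    have hcont : Tendsto (fun c : ℝ => c • x) (𝓝 1) (𝓝 x) := by
      have : Continuous fun c : ℝ => c • x := continuous_id.smul continuous_const
      simpa using this.tendsto 1
    filter_upwards [Ioi_mem_nhds (zero_lt_one' ℝ), hcont.eventually hφ] with c hc hφc
    rw [one_smul]
    exact gradient_smul_of_oneHomogeneous hc hφx hφc hhom
  have h0 := fderiv_apply_self_of_homogeneous (a := fun _ => (1 : ℝ)) hg (hasDerivAt_const 1 1) hev
  rw [zero_smul] at h0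
  rw [h0, zero_add]

/-! ### Tangential curl of the normal form -/

/-- **`curl ∇θ (x) = 0` for `θ` of class `C²` at `x`** (local form of the tree's `curl_gradient_eq_zero_holds`:
symmetry of `D²θ(x)`, Mathlib's `ContDiffAt.isSymmSndFDerivAt`). [cite: MajdaBertozziCUP2002, §2.4.1 eq. (2.96)] -/
theorem curl_gradient_eq_zero_of_contDiffAt {θ : EuclideanSpace ℝ (Fin 3) → ℝ} {x : EuclideanSpace ℝ (Fin 3)}
    (hθ : ContDiffAt ℝ 2 θ x) : curl (gradient θ) x = 0 := by
  have hsymm : IsSymmSndFDerivAt ℝ θ x :=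
    hθ.isSymmSndFDerivAt (by simp only [minSmoothness_of_isRCLikeNormedField]; exact le_rfl)
  have hD : DifferentiableAt ℝ (fderiv ℝ θ) x :=
    (hθ.fderiv_right (m := 1) (by norm_num)).differentiableAt (by simp)
  have hgrad : HasFDerivAt (gradient θ)
      (((InnerProductSpace.toDual ℝ (EuclideanSpace ℝ (Fin 3))).symm :
          (EuclideanSpace ℝ (Fin 3) →L[ℝ] ℝ) →L[ℝ] EuclideanSpace ℝ (Fin 3)).comp (fderiv ℝ (fderiv ℝ θ) x)) x :=
    (InnerProductSpace.toDual ℝ (EuclideanSpace ℝ (Fin 3))).symm.hasFDerivAt.comp x hD.hasFDerivAt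
  have hcomp : ∀ u v : EuclideanSpace ℝ (Fin 3), ⟪fderiv ℝ (gradient θ) x u, v⟫ = fderiv ℝ (fderiv ℝ θ) x u v := by
    intro u v
    rw [hgrad.fderiv]
    exact InnerProductSpace.toDual_symm_apply
  have hS : ∀ i j : Fin 3, fderiv ℝ (gradient θ) x (EuclideanSpace.single j 1) i =
      fderiv ℝ (gradient θ) x (EuclideanSpace.single i 1) j := by
    intro i j
    have h1 : fderiv ℝ (gradient θ) x (EuclideanSpace.single j 1) i
        = ⟪fderiv ℝ (gradient θ) x (EuclideanSpace.single j 1), EuclideanSpace.single i 1⟫ := by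
      rw [EuclideanSpace.inner_single_right]; simp
    have h2 : fderiv ℝ (gradient θ) x (EuclideanSpace.single i 1) j
        = ⟪fderiv ℝ (gradient θ) x (EuclideanSpace.single i 1), EuclideanSpace.single j 1⟫ := by
      rw [EuclideanSpace.inner_single_right]; simp
    rw [h1, h2, hcomp, hcomp, hsymm]
  rw [curl_eq_curlCLM, curlCLM_apply]
  ext i
  fin_cases i <;> simp [hS]

/-- **Poloidal fields in normal form have tangential curl**: `⟪curl (2∇φ − ψ y)(x), x⟫ = 0` for `φ ∈ C²` at `x` and
`ψ` differentiable at `x` (`curl ∇φ = 0`, `curl(ψ y) = ∇ψ × y ⊥ y`). [folklore] -/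
theorem inner_curl_sub_smul_self {φ ψ : EuclideanSpace ℝ (Fin 3) → ℝ} {x : EuclideanSpace ℝ (Fin 3)}
    (hφ : ContDiffAt ℝ 2 φ x) (hψ : DifferentiableAt ℝ ψ x) :
    ⟪curl (fun y => (2 : ℝ) • gradient φ y - ψ y • y) x, x⟫ = 0 := by
  have hg : DifferentiableAt ℝ (gradient φ) x := by
    have hD : DifferentiableAt ℝ (fderiv ℝ φ) x :=
      (hφ.fderiv_right (m := 1) (by norm_num)).differentiableAt (by simp)
    exact ((InnerProductSpace.toDual ℝ (EuclideanSpace ℝ (Fin 3))).symm.differentiableAt).comp x hD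
  have h1 : DifferentiableAt ℝ (fun y => (2 : ℝ) • gradient φ y) x := hg.const_smul (2 : ℝ)
  have h2 : DifferentiableAt ℝ (fun y => ψ y • y) x := hψ.smul differentiableAt_id
  rw [curl_sub h1 h2, curl_const_smul hg, curl_gradient_eq_zero_of_contDiffAt hφ, smul_zero, zero_sub,
    inner_neg_left, curl_smul_self hψ, inner_cross_self_right' , neg_zero]

end PoloidalField

end Summit.NavierStokesRegularity.NavierStokesRegularity.Theorems.PoloidalLiouville

end
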